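import Literature.Geometry.ComplexAnalytic.HolomorphicSplittingLemma
import HarnessLib

/-!
# The holomorphic splitting lemma along a critical curve (Morse lemma with a holomorphic parameter)

Layer `Literature/Geometry/ComplexAnalytic`; theorems only. Written by the prover seat `hodge-nonav-prover-Bx` (g16, cell
`hodge-nonav`) as brick B4a of the programme «A₃-TRACE» (crux K1-B of `Summits/HodgeConjecture/HodgeConjecture/Theses/SignSymmetricPowers.lean`,
stmt-HodgeConjecture-19716), sequel of `HolomorphicSplittingLemma` (the chart at the origin for a function vanishing on
the parameter axis with its `w`-partials).

**Theorem (AGZV I §9.6 "Morse lemma with parameters" / Ebeling Prop. 3.13, holomorphic, general position of the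
critical curve).** Let `φ` be holomorphic on an open `U ∋ 0` of `Fin (m + 2) → ℂ` (coordinates `w = Fin.init z`,
parameter `u = z last`) with `dφ(0) = 0` and second derivative at `0` non-degenerate on the `w`-space, and let
`u ↦ (c u, u)` be a holomorphic curve through `0` in `U` consisting of critical points of the restrictions `φ(·, u)`.
Then near `0` there is a holomorphic chart `Θ` preserving the parameter with
`φ z = φ (c (z last), z last) + Σᵢ (Θ z)ᵢ.castSucc²` (`exists_splittingChart_of_criticalCurve`).  Proof: the shear
`(w, u) ↦ (w - c u, u)` moves the critical curve to the axis, and `F (w, u) = φ (w + c u, u) - φ (c u, u)` satisfies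
the hypotheses of `exists_splittingChart_zero` (its `w`-Hessian at `0` is that of `φ`, read off on the slice `u = 0`
where `F = φ - φ 0`).

## References

* [ArnoldGuseinZadeVarchenko1985] V. I. Arnold, S. M. Gusein-Zade, A. N. Varchenko, *Singularities of Differentiable Maps* I,
  §9.6 (Morse lemma with parameters), §11.1.
* [Ebeling2007] W. Ebeling, *Functions of Several Complex Variables and Their Singularities*, Prop. 3.12–3.13.
* [Milnor1963] J. Milnor, *Morse theory*, Lemma 2.2.
-/

noncomputable section

open Set Function Filter Module Metric
open scoped Topology ContDiff

set_option maxSynthPendingDepth 2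

namespace Literature.Geometry.ComplexAnalytic

namespace HolomorphicSplitting

variable {m : ℕ}

/-- `Fin.snoc` is additive in both arguments. [folklore] -/
private theorem snoc_add'' (u u' : Fin (m + 1) → ℂ) (x x' : ℂ) :
    (Fin.snoc (u + u') (x + x') : Fin (m + 2) → ℂ) = Fin.snoc u x + Fin.snoc u' x' := by
  funext k
  refine Fin.lastCases ?_ (fun j => ?_) k
  · simp [Fin.snoc_last]
  · simp [Fin.snoc_castSucc]

/-- Strict polydisc bound for `Fin.snoc`. [folklore] -/
private theorem norm_snoc_lt {w : Fin (m + 1) → ℂ} {x : ℂ} {R : ℝ} (hR : 0 < R) (hw : ‖w‖ < R) (hx : ‖x‖ < R) :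
    ‖(Fin.snoc w x : Fin (m + 2) → ℂ)‖ < R :=
  (pi_norm_lt_iff hR).2 fun k => Fin.lastCases (by simpa using hx)
    (fun j => by rw [Fin.snoc_castSucc]; exact (norm_le_pi_norm w j).trans_lt hw) k

/-- `Fin.snoc 0 0 = 0`. [folklore] -/
private theorem snoc_zero_zero : (Fin.snoc (0 : Fin (m + 1) → ℂ) (0 : ℂ) : Fin (m + 2) → ℂ) = 0 := by
  funext k
  refine Fin.lastCases ?_ (fun j => ?_) k
  · simp [Fin.snoc_last]
  · simp [Fin.snoc_castSucc]

/-- **The holomorphic splitting lemma along a critical curve** (AGZV I §9.6, Ebeling Prop. 3.13: "Morse lemma with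
parameters").  Let `φ` be holomorphic on an open `U ∋ 0` of `Fin (m + 2) → ℂ` with `dφ(0) = 0` and second derivative
`L` at `0` non-degenerate on the `w`-space `{z last = 0}`, and let `u ↦ (c u, u)` (`c` holomorphic on `‖u‖ < r₁`,
`c 0 = 0`) be a curve in `U` of critical points of the restrictions `φ(·, u)` (`∂φ/∂wᵢ (c u, u) = 0`).  Then there is
an open partial homeomorphism `Θ` of `Fin (m + 2) → ℂ`, `0 ∈ Θ.source ⊆ U ∩ {‖z last‖ < r₁}`, `Θ 0 = 0`, holomorphic,
real `C^∞` with `C^∞` inverse, preserving the parameter `z last`, with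
`φ z = φ (c (z last), z last) + Σᵢ (Θ z)ᵢ.castSucc²` on `Θ.source`: the function splits as its restriction to the
critical curve plus a non-degenerate quadratic form in coordinates depending holomorphically on the parameter.
(Reduction to `exists_splittingChart_zero` by the shear `(w, u) ↦ (w - c u, u)`.)
[cite: ArnoldGuseinZadeVarchenko1985, §9.6] [cite: Ebeling2007, Prop. 3.13] [cite: Milnor1963, Lemma 2.2] -/
theorem exists_splittingChart_of_criticalCurve {U : Set (Fin (m + 2) → ℂ)} (hU : IsOpen U)
    {φ : (Fin (m + 2) → ℂ) → ℂ} (hφ : DifferentiableOn ℂ φ U) (h0 : (0 : Fin (m + 2) → ℂ) ∈ U)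
    {r₁ : ℝ} (hr₁ : 0 < r₁) {c : ℂ → (Fin (m + 1) → ℂ)} (hc : DifferentiableOn ℂ c (ball 0 r₁)) (hc0 : c 0 = 0)
    (hcU : ∀ u ∈ ball (0 : ℂ) r₁, (Fin.snoc (c u) u : Fin (m + 2) → ℂ) ∈ U)
    (hcrit : ∀ u ∈ ball (0 : ℂ) r₁, ∀ i : Fin (m + 1),
      fderiv ℂ φ (Fin.snoc (c u) u) (Pi.single i.castSucc 1) = 0)
    (h1 : fderiv ℂ φ 0 = 0) {L : (Fin (m + 2) → ℂ) →L[ℂ] (Fin (m + 2) → ℂ) →L[ℂ] ℂ}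
    (h2 : HasFDerivAt (fderiv ℂ φ) L 0)
    (hL : ∀ u : Fin (m + 1) → ℂ, (∀ v : Fin (m + 1) → ℂ, L (Fin.snoc u 0) (Fin.snoc v 0) = 0) → u = 0) :
    ∃ Θ : OpenPartialHomeomorph (Fin (m + 2) → ℂ) (Fin (m + 2) → ℂ),
      (0 : Fin (m + 2) → ℂ) ∈ Θ.source ∧ Θ 0 = 0 ∧ Θ.source ⊆ U ∧
      (∀ z ∈ Θ.source, ‖z (Fin.last (m + 1))‖ < r₁) ∧
      DifferentiableOn ℂ Θ Θ.source ∧ ContDiffOn ℝ ∞ Θ Θ.source ∧ ContDiffOn ℝ ∞ Θ.symm Θ.target ∧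
      (∀ z ∈ Θ.source, Θ z (Fin.last (m + 1)) = z (Fin.last (m + 1))) ∧
      ∀ z ∈ Θ.source, φ z = φ (Fin.snoc (c (z (Fin.last (m + 1)))) (z (Fin.last (m + 1)))) +
        ∑ i : Fin (m + 1), (Θ z i.castSucc) ^ 2 := by
  classical
  -- coordinate maps
  let prL : (Fin (m + 2) → ℂ) →L[ℂ] ℂ :=
    ContinuousLinearMap.proj (R := ℂ) (φ := fun _ : Fin (m + 2) => ℂ) (Fin.last (m + 1))
  have hprL : ∀ z, prL z = z (Fin.last (m + 1)) := fun z => rfl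
  let J : (Fin (m + 1) → ℂ) →L[ℂ] (Fin (m + 2) → ℂ) :=
    ContinuousLinearMap.pi (Fin.snoc (α := fun _ : Fin (m + 2) => (Fin (m + 1) → ℂ) →L[ℂ] ℂ)
      (fun j : Fin (m + 1) => ContinuousLinearMap.proj (R := ℂ) (φ := fun _ : Fin (m + 1) => ℂ) j) 0)
  have hJ : ∀ w, J w = Fin.snoc w 0 := by
    intro w
    funext k
    refine Fin.lastCases ?_ (fun j => ?_) k
    · simp [J, Fin.snoc_last]
    · simp [J, Fin.snoc_castSucc]
  have hJlast : ∀ w, J w (Fin.last (m + 1)) = 0 := fun w => by rw [hJ, Fin.snoc_last]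
  let K : (Fin (m + 2) → ℂ) →L[ℂ] (Fin (m + 2) → ℂ) :=
    ContinuousLinearMap.pi (Fin.snoc (α := fun _ : Fin (m + 2) => (Fin (m + 2) → ℂ) →L[ℂ] ℂ)
      (fun _ : Fin (m + 1) => (0 : (Fin (m + 2) → ℂ) →L[ℂ] ℂ))
      (ContinuousLinearMap.proj (R := ℂ) (φ := fun _ : Fin (m + 2) => ℂ) (Fin.last (m + 1))))
  have hK : ∀ z, K z = Fin.snoc (0 : Fin (m + 1) → ℂ) (z (Fin.last (m + 1))) := by
    intro z
    funext k
    refine Fin.lastCases ?_ (fun j => ?_) k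
    · simp [K, Fin.snoc_last]
    · simp [K, Fin.snoc_castSucc]
  have hJsnoc : ∀ (w : Fin (m + 1) → ℂ) (u : ℂ), J w + Fin.snoc (0 : Fin (m + 1) → ℂ) u = Fin.snoc w u := by
    intro w u
    rw [hJ, ← snoc_add'', add_zero, zero_add]
  have hlast_sub : ∀ (z : Fin (m + 2) → ℂ) (w : Fin (m + 1) → ℂ), (z - J w) (Fin.last (m + 1)) = z (Fin.last (m + 1)) :=
    fun z w => by rw [Pi.sub_apply, hJlast, sub_zero]
  have hlast_add : ∀ (z : Fin (m + 2) → ℂ) (w : Fin (m + 1) → ℂ), (z + J w) (Fin.last (m + 1)) = z (Fin.last (m + 1)) :=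
    fun z w => by rw [Pi.add_apply, hJlast, add_zero]
  -- the strip `‖z last‖ < r₁` and the shear `T z = z - J (c (z last))`
  have hSo : IsOpen {z : Fin (m + 2) → ℂ | ‖z (Fin.last (m + 1))‖ < r₁} :=
    isOpen_lt (continuous_norm.comp (continuous_apply _)) continuous_const
  have hcS : ContinuousOn (fun z : Fin (m + 2) → ℂ => c (z (Fin.last (m + 1))))
      {z : Fin (m + 2) → ℂ | ‖z (Fin.last (m + 1))‖ < r₁} :=
    hc.continuousOn.comp (continuous_apply _).continuousOn fun z hz => mem_ball_zero_iff.2 hz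
  let T : OpenPartialHomeomorph (Fin (m + 2) → ℂ) (Fin (m + 2) → ℂ) :=
    { toFun := fun z => z - J (c (z (Fin.last (m + 1))))
      invFun := fun z => z + J (c (z (Fin.last (m + 1))))
      source := {z | ‖z (Fin.last (m + 1))‖ < r₁}
      target := {z | ‖z (Fin.last (m + 1))‖ < r₁}
      map_source' := fun z hz => by
        show ‖(z - J (c (z (Fin.last (m + 1))))) (Fin.last (m + 1))‖ < r₁
        rw [hlast_sub]; exact hz
      map_target' := fun z hz => by
        show ‖(z + J (c (z (Fin.last (m + 1))))) (Fin.last (m + 1))‖ < r₁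
        rw [hlast_add]; exact hz
      left_inv' := fun z _ => by
        show z - J (c (z (Fin.last (m + 1)))) +
          J (c ((z - J (c (z (Fin.last (m + 1))))) (Fin.last (m + 1)))) = z
        rw [hlast_sub, sub_add_cancel]
      right_inv' := fun z _ => by
        show z + J (c (z (Fin.last (m + 1)))) -
          J (c ((z + J (c (z (Fin.last (m + 1))))) (Fin.last (m + 1)))) = z
        rw [hlast_add, add_sub_cancel_right]
      open_source := hSo
      open_target := hSo
      continuousOn_toFun := continuousOn_id.sub (J.continuous.comp_continuousOn hcS)
      continuousOn_invFun := continuousOn_id.add (J.continuous.comp_continuousOn hcS) }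
  have hT : ∀ z, T z = z - J (c (z (Fin.last (m + 1)))) := fun z => rfl
  have hTsrc : T.source = {z | ‖z (Fin.last (m + 1))‖ < r₁} := rfl
  have hTtgt : T.target = {z | ‖z (Fin.last (m + 1))‖ < r₁} := rfl
  have hTlast : ∀ z, T z (Fin.last (m + 1)) = z (Fin.last (m + 1)) := fun z => hlast_sub z _
  have hT0 : T 0 = 0 := by rw [hT, Pi.zero_apply, hc0, map_zero, sub_zero]
  -- derivatives of the shear and of its inverse on the strip
  have hcd : ∀ u ∈ ball (0 : ℂ) r₁, HasFDerivAt c (fderiv ℂ c u) u := fun u hu =>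
    (hc.differentiableAt (isOpen_ball.mem_nhds hu)).hasFDerivAt
  have hcS' : ∀ z ∈ {z : Fin (m + 2) → ℂ | ‖z (Fin.last (m + 1))‖ < r₁},
      HasFDerivAt (fun z : Fin (m + 2) → ℂ => c (z (Fin.last (m + 1))))
        ((fderiv ℂ c (z (Fin.last (m + 1)))).comp prL) z :=
    fun z hz => (hcd _ (mem_ball_zero_iff.2 hz)).comp z prL.hasFDerivAt
  have hTd' : ∀ z ∈ {z : Fin (m + 2) → ℂ | ‖z (Fin.last (m + 1))‖ < r₁},
      HasFDerivAt (fun z : Fin (m + 2) → ℂ => z - J (c (z (Fin.last (m + 1)))))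
        (ContinuousLinearMap.id ℂ _ - J.comp ((fderiv ℂ c (z (Fin.last (m + 1)))).comp prL)) z :=
    fun z hz => (hasFDerivAt_id z).sub (J.hasFDerivAt.comp z (hcS' z hz))
  have hTsd' : ∀ z ∈ {z : Fin (m + 2) → ℂ | ‖z (Fin.last (m + 1))‖ < r₁},
      HasFDerivAt (fun z : Fin (m + 2) → ℂ => z + J (c (z (Fin.last (m + 1)))))
        (ContinuousLinearMap.id ℂ _ + J.comp ((fderiv ℂ c (z (Fin.last (m + 1)))).comp prL)) z :=
    fun z hz => (hasFDerivAt_id z).add (J.hasFDerivAt.comp z (hcS' z hz))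
  have hTd : DifferentiableOn ℂ T T.source := fun z hz => (hTd' z hz).differentiableAt.differentiableWithinAt
  have hTsd : DifferentiableOn ℂ T.symm T.target := fun z hz =>
    (hTsd' z hz).differentiableAt.differentiableWithinAt
  have hTcd : ContDiffOn ℝ ∞ T T.source :=
    ((Literature.Analysis.Complex.SCV.analyticOnNhd_of_differentiableOn hTd hSo).contDiffOn_of_completeSpace
      (n := ∞)).restrict_scalars ℝ
  have hTscd : ContDiffOn ℝ ∞ T.symm T.target :=
    ((Literature.Analysis.Complex.SCV.analyticOnNhd_of_differentiableOn hTsd hSo).contDiffOn_of_completeSpace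
      (n := ∞)).restrict_scalars ℝ
  -- the radius `r`: `ball 0 r ⊆ strip ∩ T.symm ⁻¹' U`
  have hWo : IsOpen ({z : Fin (m + 2) → ℂ | ‖z (Fin.last (m + 1))‖ < r₁} ∩
      (fun z => z + J (c (z (Fin.last (m + 1))))) ⁻¹' U) :=
    (continuousOn_id.add (J.continuous.comp_continuousOn hcS)).isOpen_inter_preimage hSo hU
  have h0W : (0 : Fin (m + 2) → ℂ) ∈ {z : Fin (m + 2) → ℂ | ‖z (Fin.last (m + 1))‖ < r₁} ∩
      (fun z => z + J (c (z (Fin.last (m + 1))))) ⁻¹' U := by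
    refine ⟨by simpa using hr₁, ?_⟩
    show (0 : Fin (m + 2) → ℂ) + J (c ((0 : Fin (m + 2) → ℂ) (Fin.last (m + 1)))) ∈ U
    rw [Pi.zero_apply, hc0, map_zero, add_zero]; exact h0
  obtain ⟨r, hr, hrW⟩ := Metric.isOpen_iff.1 hWo 0 h0W
  have hrS : ∀ z ∈ ball (0 : Fin (m + 2) → ℂ) r, ‖z (Fin.last (m + 1))‖ < r₁ := fun z hz => (hrW hz).1
  have hrU : ∀ z ∈ ball (0 : Fin (m + 2) → ℂ) r, z + J (c (z (Fin.last (m + 1)))) ∈ U := fun z hz => (hrW hz).2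
  have hrb : ∀ z ∈ ball (0 : Fin (m + 2) → ℂ) r, z (Fin.last (m + 1)) ∈ ball (0 : ℂ) r₁ := fun z hz =>
    mem_ball_zero_iff.2 (hrS z hz)
  -- the sheared function `F z = φ (z + J (c (z last))) - φ (c (z last), z last)`
  set F : (Fin (m + 2) → ℂ) → ℂ := fun z =>
    φ (z + J (c (prL z))) - φ (J (c (prL z)) + K z) with hFdef
  have hφd' : ∀ x ∈ U, HasFDerivAt φ (fderiv ℂ φ x) x := fun x hx =>
    (hφ.differentiableAt (hU.mem_nhds hx)).hasFDerivAt
  have hAU : ∀ z ∈ ball (0 : Fin (m + 2) → ℂ) r, J (c (prL z)) + K z ∈ U := fun z hz => by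
    rw [hK, hprL, hJsnoc]; exact hcU _ (hrb z hz)
  have hAd : ∀ z ∈ ball (0 : Fin (m + 2) → ℂ) r, HasFDerivAt (fun z => J (c (prL z)) + K z)
      (J.comp ((fderiv ℂ c (z (Fin.last (m + 1)))).comp prL) + K) z :=
    fun z hz => (J.hasFDerivAt.comp z (hcS' z (hrS z hz))).add K.hasFDerivAt
  have hF' : ∀ z ∈ ball (0 : Fin (m + 2) → ℂ) r, HasFDerivAt F
      ((fderiv ℂ φ (z + J (c (prL z)))).comp
          (ContinuousLinearMap.id ℂ _ + J.comp ((fderiv ℂ c (z (Fin.last (m + 1)))).comp prL)) -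
        (fderiv ℂ φ (J (c (prL z)) + K z)).comp (J.comp ((fderiv ℂ c (z (Fin.last (m + 1)))).comp prL) + K)) z :=
    fun z hz => ((hφd' _ (hrU z hz)).comp z (hTsd' z (hrS z hz))).sub ((hφd' _ (hAU z hz)).comp z (hAd z hz))
  have hFd : DifferentiableOn ℂ F (ball 0 r) := fun z hz => (hF' z hz).differentiableAt.differentiableWithinAt
  -- `F` vanishes on the axis together with its `w`-partials, and `dF(0) = 0`
  have hax : ∀ z ∈ ball (0 : Fin (m + 2) → ℂ) r, F (Fin.snoc (0 : Fin (m + 1) → ℂ) (z (Fin.last (m + 1)))) = 0 := by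
    intro z _
    simp only [hFdef, hprL, hK, Fin.snoc_last]
    rw [add_comm (Fin.snoc _ _ : Fin (m + 2) → ℂ) (J _), sub_self]
  have hcritF : ∀ z ∈ ball (0 : Fin (m + 2) → ℂ) r, ∀ i : Fin (m + 1),
      fderiv ℂ F (Fin.snoc (0 : Fin (m + 1) → ℂ) (z (Fin.last (m + 1)))) (Pi.single i.castSucc 1) = 0 := by
    intro z hz i
    have hz₀b : (Fin.snoc (0 : Fin (m + 1) → ℂ) (z (Fin.last (m + 1))) : Fin (m + 2) → ℂ) ∈
        ball (0 : Fin (m + 2) → ℂ) r := by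
      rw [mem_ball_zero_iff]
      exact norm_snoc_lt hr (by simpa using hr) ((norm_le_pi_norm z _).trans_lt (mem_ball_zero_iff.1 hz))
    have hel : (Pi.single i.castSucc (1 : ℂ) : Fin (m + 2) → ℂ) (Fin.last (m + 1)) = 0 :=
      Pi.single_eq_of_ne (Fin.castSucc_lt_last i).ne' _
    have hpe : prL (Pi.single i.castSucc (1 : ℂ)) = 0 := by rw [hprL, hel]
    have hKe : K (Pi.single i.castSucc (1 : ℂ)) = 0 := by rw [hK, hel, snoc_zero_zero]
    rw [(hF' _ hz₀b).fderiv]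
    simp only [sub_apply, add_apply, ContinuousLinearMap.comp_apply, ContinuousLinearMap.coe_id', id, hpe, hKe,
      map_zero, add_zero, sub_zero]
    have hpt : (Fin.snoc (0 : Fin (m + 1) → ℂ) (z (Fin.last (m + 1))) : Fin (m + 2) → ℂ) +
        J (c (prL (Fin.snoc (0 : Fin (m + 1) → ℂ) (z (Fin.last (m + 1)))))) =
        Fin.snoc (c (z (Fin.last (m + 1)))) (z (Fin.last (m + 1))) := by
      rw [hprL, Fin.snoc_last]
      exact (add_comm _ _).trans (hJsnoc _ _)
    rw [hpt]
    exact hcrit _ (hrb z hz) i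
  have h1F : fderiv ℂ F 0 = 0 := by
    rw [(hF' 0 (mem_ball_self hr)).fderiv]
    have h00 : (0 : Fin (m + 2) → ℂ) + J (c (prL 0)) = 0 := by rw [map_zero, hc0, map_zero, add_zero]
    have h01 : J (c (prL 0)) + K 0 = 0 := by rw [map_zero, hc0, map_zero, map_zero, add_zero]
    rw [h00, h01, h1, ContinuousLinearMap.zero_comp, ContinuousLinearMap.zero_comp, sub_zero]
  -- `F` is analytic, hence twice differentiable at `0`; its `w`-Hessian at `0` is that of `φ`
  have h2F : HasFDerivAt (fderiv ℂ F) (fderiv ℂ (fderiv ℂ F) 0) 0 := by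
    have hFω : ContDiffAt ℂ ω F 0 :=
      (Literature.Analysis.Complex.SCV.analyticOnNhd_of_differentiableOn hFd isOpen_ball 0
        (mem_ball_self hr)).contDiffAt
    exact ((hFω.fderiv_right (m := 1) le_top).differentiableAt one_ne_zero).hasFDerivAt
  have hFJ : ∀ w, F (J w) = φ (J w) - φ 0 := by
    intro w
    have hpJ : prL (J w) = 0 := by rw [hprL, hJlast]
    have hKJ : K (J w) = 0 := by rw [hK, hJlast, snoc_zero_zero]
    simp only [hFdef]
    rw [hpJ, hc0, map_zero, add_zero, hKJ, add_zero]
  have hJb : ∀ w ∈ ball (0 : Fin (m + 1) → ℂ) r, J w ∈ ball (0 : Fin (m + 2) → ℂ) r := fun w hw => by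
    rw [mem_ball_zero_iff, hJ]
    exact norm_snoc_lt hr (mem_ball_zero_iff.1 hw) (by simpa using hr)
  have hJU : ∀ w ∈ ball (0 : Fin (m + 1) → ℂ) r, J w ∈ U := fun w hw => by
    have h := hrU (J w) (hJb w hw)
    rwa [hJlast, hc0, map_zero, add_zero] at h
  let Λ : ((Fin (m + 2) → ℂ) →L[ℂ] ℂ) →L[ℂ] ((Fin (m + 1) → ℂ) →L[ℂ] ℂ) :=
    (ContinuousLinearMap.compL ℂ (Fin (m + 1) → ℂ) (Fin (m + 2) → ℂ) ℂ).flip J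
  have hΛ : ∀ f : (Fin (m + 2) → ℂ) →L[ℂ] ℂ, Λ f = f.comp J := fun f => by
    simp only [Λ, ContinuousLinearMap.flip_apply, ContinuousLinearMap.compL_apply]
  have hev : (fun w => Λ (fderiv ℂ F (J w))) =ᶠ[𝓝 0] fun w => Λ (fderiv ℂ φ (J w)) := by
    filter_upwards [isOpen_ball.mem_nhds (mem_ball_self hr)] with w hw
    rw [hΛ, hΛ]
    have hdF : HasFDerivAt (fun w => F (J w)) ((fderiv ℂ F (J w)).comp J) w :=
      (hFd.differentiableAt (isOpen_ball.mem_nhds (hJb w hw))).hasFDerivAt.comp w J.hasFDerivAt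
    have hdφ : HasFDerivAt (fun w => φ (J w) - φ 0) ((fderiv ℂ φ (J w)).comp J) w :=
      ((hφd' _ (hJU w hw)).comp w J.hasFDerivAt).sub_const _
    have heq : (fun w => F (J w)) = fun w => φ (J w) - φ 0 := funext hFJ
    rw [heq] at hdF
    exact hdF.unique hdφ
  have hG₁ : HasFDerivAt (fun w => Λ (fderiv ℂ F (J w))) (Λ.comp ((fderiv ℂ (fderiv ℂ F) 0).comp J)) 0 := by
    have h2F' : HasFDerivAt (fderiv ℂ F) (fderiv ℂ (fderiv ℂ F) 0) (J 0) := by rw [map_zero]; exact h2F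
    exact Λ.hasFDerivAt.comp 0 (h2F'.comp 0 J.hasFDerivAt)
  have hG₂ : HasFDerivAt (fun w => Λ (fderiv ℂ φ (J w))) (Λ.comp (L.comp J)) 0 := by
    have h2' : HasFDerivAt (fderiv ℂ φ) L (J 0) := by rw [map_zero]; exact h2
    exact Λ.hasFDerivAt.comp 0 (h2'.comp 0 J.hasFDerivAt)
  have hLFL : ∀ u v : Fin (m + 1) → ℂ,
      fderiv ℂ (fderiv ℂ F) 0 (Fin.snoc u 0) (Fin.snoc v 0) = L (Fin.snoc u 0) (Fin.snoc v 0) := by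
    intro u v
    have huniq : Λ.comp ((fderiv ℂ (fderiv ℂ F) 0).comp J) = Λ.comp (L.comp J) :=
      hG₁.unique (hG₂.congr_of_eventuallyEq hev)
    have h := congrArg (fun T => T u v) huniq
    simp only [ContinuousLinearMap.comp_apply, hΛ] at h
    rw [← hJ, ← hJ]
    exact h
  have hLF : ∀ u : Fin (m + 1) → ℂ, (∀ v, fderiv ℂ (fderiv ℂ F) 0 (Fin.snoc u 0) (Fin.snoc v 0) = 0) → u = 0 :=
    fun u hu => hL u fun v => by rw [← hLFL]; exact hu v
  -- the splitting chart of `F` at `0`, pulled back by the shear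
  obtain ⟨Θ₀, h0Θ₀, hΘ₀0, hΘ₀ball, hΘ₀d, hΘ₀cd, hΘ₀symm, hΘ₀last, hΘ₀F⟩ :=
    exists_splittingChart_zero hr hFd hax hcritF h1F h2F hLF
  refine ⟨T.trans Θ₀, ?_, ?_, ?_, ?_, ?_, ?_, ?_, ?_, ?_⟩
  · rw [OpenPartialHomeomorph.trans_source]
    exact ⟨by rw [hTsrc]; simpa using hr₁, by rw [mem_preimage, hT0]; exact h0Θ₀⟩
  · rw [OpenPartialHomeomorph.coe_trans, Function.comp_apply, hT0, hΘ₀0]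
  · intro z hz
    rw [OpenPartialHomeomorph.trans_source] at hz
    have h := hrU (T z) (hΘ₀ball hz.2)
    rwa [hTlast, hT, sub_add_cancel] at h
  · intro z hz
    rw [OpenPartialHomeomorph.trans_source] at hz
    exact hz.1
  · rw [OpenPartialHomeomorph.coe_trans, OpenPartialHomeomorph.trans_source]
    exact hΘ₀d.comp (hTd.mono inter_subset_left) fun z hz => hz.2
  · rw [OpenPartialHomeomorph.coe_trans, OpenPartialHomeomorph.trans_source]
    exact hΘ₀cd.comp (hTcd.mono inter_subset_left) fun z hz => hz.2
  · rw [OpenPartialHomeomorph.coe_trans_symm, OpenPartialHomeomorph.trans_target]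
    exact hTscd.comp (hΘ₀symm.mono inter_subset_left) fun z hz => hz.2
  · intro z hz
    rw [OpenPartialHomeomorph.trans_source] at hz
    rw [OpenPartialHomeomorph.coe_trans, Function.comp_apply, hΘ₀last _ hz.2, hTlast]
  · intro z hz
    rw [OpenPartialHomeomorph.trans_source] at hz
    have h := hΘ₀F (T z) hz.2
    have hFT : F (T z) = φ z - φ (Fin.snoc (c (z (Fin.last (m + 1)))) (z (Fin.last (m + 1)))) := by
      simp only [hFdef]
      rw [hprL, hTlast, hK, hTlast, hJsnoc, hT, sub_add_cancel]
    simp only [OpenPartialHomeomorph.coe_trans, Function.comp_apply]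
    rw [← h, hFT]
    ring

end HolomorphicSplitting

end Literature.Geometry.ComplexAnalytic

end
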